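import Literature.NumberTheory.LFunctions.WeilExplicitArchTermParityProofs
import Literature.NumberTheory.LFunctions.WeilArchimedeanPositivityProofs
import Literature.Analysis.SpecialFunctions.DigammaReflection
import Literature.Analysis.SpecialFunctions.DigammaLogBound
import Mathlib.Analysis.Complex.Trigonometric
import HarnessLib

/-!
# The parity term of the twisted archimedean factor is a `sech` kernel (Weil 1952 (10)/(11))

Sibling of `WeilExplicitArchTermParityProofs.lean` (position form of
`weilArchIntegralChar a g = ∫ ĝ(1/2+it) Re ψ(1/4 + a/2 + it/2) dt`, `a ∈ {0, 1}`, the kernel of the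
explicit formula of an `L(s, χ)` with Gamma factor `Γ_ℝ(s + a)`).  The DIFFERENCE between the odd
(`a = 1`) and the even (`a = 0`) archimedean functional — the «parity term» that every comparison of
`Q_χ` (odd `χ`) with `Q_ζ` carries (cell rh-explicit, GRH arm: TRANSFER.md, base-rung-log2half-CERT,
reflection-bonus-CERT; TYPING-SPEC-grh2 T3/T6) — is an explicit POSITIVE kernel on both sides of the
Fourier dictionary:

* frequency side (`re_digamma_three_quarters_sub_quarter`): for every real `y`,
  `Re ψ(3/4 + iy) − Re ψ(1/4 + iy) = π / cosh(2πy)`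
  (reflection formula `ψ(1 − s) − ψ(s) = π cot(πs)` at `s = 1/4 + iy`, `1 − s = conj(3/4 + iy)`,
  `Re cot(π/4 + iw) = 1/cosh(2w)`); on the critical line, `Re ψ(3/4 + it/2) − Re ψ(1/4 + it/2) = π sech(πt)`;
* position side (`weilArchIntegralChar_one_sub_zero`): for every test function `g`,
  `weilArchIntegralChar 1 g − weilArchIntegralChar 0 g = 2π ∫₀^∞ (g(x) + g(−x)) dx/(2 cosh(x/2))`
  `= 2π ∫ g(x) dx/(2 cosh(x/2))` (`…_eq_integral_sech`): Bombieri's weights `e^{(1/2−a)x}/(2 sinh x)`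
  of the two parities differ by `(e^{x/2} − e^{−x/2})/(2 sinh x) = 1/(2 cosh(x/2))`, and the
  `g(0)`-terms cancel.

So `(1/2π)(A₁ − A₀)(g) = ½ ∫ g(x) sech(x/2) dx`, and at `g = φ ⋆ φ̃` this is the positive-definite
form `½ ∫∫ φ(u) conj φ(v) sech((u − v)/2) du dv = ½ ∫ |φ̂(1/2+it)|² sech(πt) dt` (`sech(x/2)/2` and
`sech(πt)` are a Fourier pair) — the quantitative form of Weil's remark that the real place of an odd
character contributes `K_{1,1} ≤ K_{1,0}` ((10)–(11), p. 258–262: `K_{1,f}(x) = e^{(1/2−f)|x|}/|eˣ − e^{−x}|`,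
so `K_{1,0} − K_{1,1} = 1/(e^{x/2} + e^{−x/2})`).  Everything is proved; no named facts.

## References

* A. Weil, *Sur les "formules explicites" de la théorie des nombres premiers*, Comm. Sém. Math. Univ.
  Lund (1952) 252–265: (10) p. 258, (11) pp. 261–262, `K_{1,f}` p. 262. [Weil1952FormulesExplicites]
* E. Bombieri, Rend. Mat. Acc. Lincei (9) 11 (2000) 183–233, §2 (2.8) (the case `a = 0`). [Bombieri2000Weil]
* G. E. Andrews, R. Askey, R. Roy, *Special Functions*, CUP 1999, (1.2.15) (reflection formula for `ψ`).
-/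

noncomputable section

open Complex Filter Set MeasureTheory
open scoped Real Topology ComplexConjugate

namespace Literature.NumberTheory.LFunctions

namespace WeilArchParity

variable {g : ℝ → ℂ}

/-! ### Frequency side: `Re ψ(3/4 + iy) − Re ψ(1/4 + iy) = π/cosh(2πy)` -/

open Literature.Analysis.SpecialFunctions.Complex in
/-- **The parity gap of the digamma kernels in closed form**: for every real `y`,
`Re ψ(3/4 + iy) − Re ψ(1/4 + iy) = π / cosh(2πy)` — the reflection formula
`ψ(1 − s) − ψ(s) = π cot(πs)` at `s = 1/4 + iy` (`1 − s = conj(3/4 + iy)`, `ψ(conj z) = conj ψ(z)`), and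
`Re cot(π/4 + iw) = (cosh²w − sinh²w)/(cosh²w + sinh²w) = 1/cosh(2w)` (`cos(π/4) = sin(π/4)`).
[cite: AndrewsAskeyRoy1999, §1.2 (1.2.15); Weil1952FormulesExplicites, (10) p. 258] -/
theorem re_digamma_three_quarters_sub_quarter (y : ℝ) :
    (Complex.digamma (3 / 4 + y * I)).re - (Complex.digamma (1 / 4 + y * I)).re =
      π / Real.cosh (2 * π * y) := by
  set s : ℂ := 1 / 4 + y * I with hs_def
  have hs : ∀ n : ℤ, s ≠ n := by
    intro n h
    have h1 := congrArg Complex.re h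
    simp only [hs_def, add_re, div_ofNat_re, one_re, mul_re, ofReal_re, I_re, mul_zero, ofReal_im,
      I_im, mul_one, sub_self, add_zero, intCast_re] at h1
    have h2 : (4 : ℝ) * n = 1 := by linarith
    have h3 : (4 : ℤ) * n = 1 := by exact_mod_cast h2
    omega
  have href := digamma_one_sub_sub_digamma hs
  have h1s : (1 : ℂ) - s = conj (3 / 4 + y * I) := by
    simp only [hs_def, map_add, map_div₀, map_ofNat, map_mul, Complex.conj_ofReal, Complex.conj_I]
    ring
  rw [h1s, Literature.NumberTheory.LFunctions.digamma_conj] at href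
  have hre := congrArg Complex.re href
  simp only [sub_re, conj_re] at hre
  rw [hre]
  have hπs : (π : ℂ) * s = ((π / 4 : ℝ) : ℂ) + ((π * y : ℝ) : ℂ) * I := by
    simp only [hs_def]; push_cast; ring
  rw [hπs, Complex.cos_add_mul_I, Complex.sin_add_mul_I, ← Complex.ofReal_cos, ← Complex.ofReal_sin,
    ← Complex.ofReal_cosh, ← Complex.ofReal_sinh, Real.cos_pi_div_four, Real.sin_pi_div_four]
  set ch : ℝ := Real.cosh (π * y)
  set sh : ℝ := Real.sinh (π * y)
  have hc0 : ((Real.sqrt 2 / 2 : ℝ) : ℂ) ≠ 0 :=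
    Complex.ofReal_ne_zero.2 (by positivity)
  have hw : ((Real.sqrt 2 / 2 : ℝ) : ℂ) * (ch : ℂ) + ((Real.sqrt 2 / 2 : ℝ) : ℂ) * (sh : ℂ) * I =
      ((Real.sqrt 2 / 2 : ℝ) : ℂ) * ((ch : ℂ) + (sh : ℂ) * I) := by ring
  have hz : (π : ℂ) * (((Real.sqrt 2 / 2 : ℝ) : ℂ) * (ch : ℂ) - ((Real.sqrt 2 / 2 : ℝ) : ℂ) * (sh : ℂ) * I) =
      ((Real.sqrt 2 / 2 : ℝ) : ℂ) * ((π : ℂ) * ((ch : ℂ) - (sh : ℂ) * I)) := by ring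
  rw [hz, hw, mul_div_mul_left _ _ hc0, Complex.div_re]
  have hch : ch ^ 2 = sh ^ 2 + 1 := Real.cosh_sq (π * y)
  have hN : ch * ch + sh * sh = Real.cosh (2 * π * y) := by
    rw [show 2 * π * y = 2 * (π * y) by ring, Real.cosh_two_mul]; ring
  have hnum1 : ((π : ℂ) * ((ch : ℂ) - (sh : ℂ) * I)).re = π * ch := by
    simp [mul_re, sub_re, mul_im]
  have hnum2 : ((π : ℂ) * ((ch : ℂ) - (sh : ℂ) * I)).im = -(π * sh) := by
    simp [mul_im, sub_im, mul_re]
  have hden1 : ((ch : ℂ) + (sh : ℂ) * I).re = ch := by simp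
  have hden2 : ((ch : ℂ) + (sh : ℂ) * I).im = sh := by simp
  rw [hnum1, hnum2, Complex.normSq_apply, hden1, hden2, ← add_div, hN]
  congr 1
  linear_combination π * hch

/-- The same on the critical line in the tree's normalisation `Re ψ(1/4 + a/2 + it/2)`:
`Re ψ(1/4 + 1/2 + it/2) − Re ψ(1/4 + 0/2 + it/2) = π / cosh(πt)` (`= π sech(πt)`).
[cite: Weil1952FormulesExplicites, (10) p. 258] -/
theorem re_digamma_par_one_sub_zero (t : ℝ) :
    (Complex.digamma (1 / 4 + ((1 : ℕ) : ℂ) / 2 + t / 2 * I)).re -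
        (Complex.digamma (1 / 4 + ((0 : ℕ) : ℂ) / 2 + t / 2 * I)).re = π / Real.cosh (π * t) := by
  have h := re_digamma_three_quarters_sub_quarter (t / 2)
  have e0 : (1 / 4 + ((0 : ℕ) : ℂ) / 2 + t / 2 * I) = 1 / 4 + ((t / 2 : ℝ) : ℂ) * I := by
    push_cast; ring
  have e1 : (1 / 4 + ((1 : ℕ) : ℂ) / 2 + t / 2 * I) = 3 / 4 + ((t / 2 : ℝ) : ℂ) * I := by
    push_cast; ring
  rw [e0, e1, h, show 2 * π * (t / 2) = π * t by ring]

/-! ### Position side: the two Bombieri weights differ by `1/(2 cosh(x/2))` -/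

/-- `(e^{x/2} − e^{−x/2})·2cosh(x/2) = 2 sinh x` (`sinh x = 2 sinh(x/2) cosh(x/2)`). [folklore] -/
private theorem exp_half_sub_exp_neg_half_mul_two_cosh (x : ℝ) :
    (Real.exp (x / 2) - Real.exp (-(x / 2))) * (2 * Real.cosh (x / 2)) = 2 * Real.sinh x := by
  have h1 : Real.exp (x / 2) - Real.exp (-(x / 2)) = 2 * Real.sinh (x / 2) := by
    rw [Real.sinh_eq]; ring
  rw [h1, show x = 2 * (x / 2) by ring, Real.sinh_two_mul]
  ring_nf

/-- Bombieri's even-parity integrand `(e^{x/2}(g(x) + g(−x)) − 2g(0))/(2 sinh x)` is integrable on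
`(0, ∞)` for a test function `g` (`integrableOn_bombieriMajorant` for `k = g + g(−·)`).
[cite: Bombieri2000Weil, §2 eq. (2.8)] -/
theorem integrableOn_bombieriIntegrand_weilSymm (hg : IsWeilTest g) :
    IntegrableOn (fun x : ℝ ↦ ((Real.exp (x / 2) : ℂ) * (g x + g (-x)) - 2 * g 0) /
      (2 * Real.sinh x : ℂ)) (Ioi 0) := by
  have hk : IsWeilTest (weilSymm g) := hg.weilSymm
  have hmaj := integrableOn_bombieriMajorant hk
  have hgc : Continuous g := hg.1.continuous
  have hcont : ContinuousOn (fun x : ℝ ↦ ((Real.exp (x / 2) : ℂ) * (g x + g (-x)) - 2 * g 0) /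
      (2 * Real.sinh x : ℂ)) (Ioi 0) := by
    refine ContinuousOn.div (Continuous.continuousOn (by fun_prop))
      (Continuous.continuousOn (by fun_prop)) fun x (hx : 0 < x) ↦ ?_
    have : Real.sinh x ≠ 0 := (Real.sinh_pos_iff.2 hx).ne'
    exact_mod_cast mul_ne_zero two_ne_zero this
  refine Integrable.mono' hmaj (hcont.aestronglyMeasurable measurableSet_Ioi) ?_
  refine (ae_restrict_iff' measurableSet_Ioi).2 (Eventually.of_forall fun x (hx : 0 < x) ↦ ?_)
  have h2s : 0 < 2 * Real.sinh x := by have := Real.sinh_pos_iff.2 hx; positivity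
  rw [norm_div, show ((2 : ℂ) * (Real.sinh x : ℂ)) = ((2 * Real.sinh x : ℝ) : ℂ) by push_cast; ring,
    Complex.norm_real, Real.norm_of_nonneg h2s.le]
  simp only [weilSymm]
  rw [show (2 : ℂ) * g 0 = g 0 + g (-0) by rw [neg_zero]; ring]

/-- **The parity term in position space.** For every test function `g`,
`weilArchIntegralChar 1 g − weilArchIntegralChar 0 g = 2π ∫₀^∞ (g(x) + g(−x))/(2 cosh(x/2)) dx`
(difference of the two position forms `weilArchIntegralChar_eq_position`, `a = 1, 0`; the weights
`e^{∓x/2}/(2 sinh x)` differ by `−1/(2 cosh(x/2))`, the `(log 4 + γ) g(0)` terms cancel).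
[cite: Weil1952FormulesExplicites, (10)–(11) pp. 258–262 (K_{1,0} − K_{1,1}); Bombieri2000Weil, §2 eq. (2.8)] -/
theorem weilArchIntegralChar_one_sub_zero (hg : IsWeilTest g) :
    weilArchIntegralChar 1 g - weilArchIntegralChar 0 g =
      2 * π * ∫ x in Ioi (0 : ℝ), (g x + g (-x)) / (2 * Real.cosh (x / 2) : ℂ) := by
  have h0 := weilArchIntegralChar_eq_position hg (a := 0) (Nat.zero_le 1)
  have h1 := weilArchIntegralChar_eq_position hg (a := 1) le_rfl
  -- the integrands in a convenient syntactic form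
  set F0 : ℝ → ℂ := fun x ↦ ((Real.exp (x / 2) : ℂ) * (g x + g (-x)) - 2 * g 0) /
    (2 * Real.sinh x : ℂ) with hF0
  set F1 : ℝ → ℂ := fun x ↦ ((Real.exp (-(x / 2)) : ℂ) * (g x + g (-x)) - 2 * g 0) /
    (2 * Real.sinh x : ℂ) with hF1
  set G : ℝ → ℂ := fun x ↦ (g x + g (-x)) / (2 * Real.cosh (x / 2) : ℂ) with hG
  have e0 : (fun x : ℝ ↦ ((Real.exp ((1 / 2 - ((0 : ℕ) : ℝ)) * x) : ℂ) * (g x + g (-x)) - 2 * g 0) /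
      (2 * Real.sinh x : ℂ)) = F0 := by
    funext x; simp only [hF0, Nat.cast_zero, sub_zero, one_div_mul_eq_div]
  have e1 : (fun x : ℝ ↦ ((Real.exp ((1 / 2 - ((1 : ℕ) : ℝ)) * x) : ℂ) * (g x + g (-x)) - 2 * g 0) /
      (2 * Real.sinh x : ℂ)) = F1 := by
    funext x
    simp only [hF1, Nat.cast_one]
    rw [show ((1 : ℝ) / 2 - 1) * x = -(x / 2) by ring]
  rw [e0] at h0
  rw [e1] at h1
  -- integrability
  have hgc : Continuous g := hg.1.continuous
  have hI0 : IntegrableOn F0 (Ioi 0) := integrableOn_bombieriIntegrand_weilSymm hg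
  have hk2 : HasCompactSupport fun x : ℝ ↦ g x + g (-x) := hg.weilSymm.2
  have hGc : Continuous G := by
    refine Continuous.div (by fun_prop) (by fun_prop) fun x ↦ ?_
    exact_mod_cast mul_ne_zero two_ne_zero (Real.cosh_pos (x / 2)).ne'
  have hGI : Integrable G := by
    refine hGc.integrable_of_hasCompactSupport ?_
    simp only [hG, div_eq_mul_inv]
    exact hk2.mul_right
  -- pointwise: `F1 = F0 - G` on `(0, ∞)`
  have hpt : ∀ x ∈ Ioi (0 : ℝ), F1 x = F0 x - G x := by
    intro x (hx : 0 < x)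
    have hsx : Real.sinh x ≠ 0 := (Real.sinh_pos_iff.2 hx).ne'
    have hcx : Real.cosh (x / 2) ≠ 0 := (Real.cosh_pos (x / 2)).ne'
    have hs : ((2 : ℂ) * (Real.sinh x : ℂ)) ≠ 0 := by exact_mod_cast mul_ne_zero two_ne_zero hsx
    have hc : ((2 : ℂ) * (Real.cosh (x / 2) : ℂ)) ≠ 0 := by exact_mod_cast mul_ne_zero two_ne_zero hcx
    have key := exp_half_sub_exp_neg_half_mul_two_cosh x
    have keyC : ((Real.exp (x / 2) : ℂ) - (Real.exp (-(x / 2)) : ℂ)) * (2 * (Real.cosh (x / 2) : ℂ)) =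
        2 * (Real.sinh x : ℂ) := by exact_mod_cast key
    simp only [hF0, hF1, hG]
    rw [div_sub_div _ _ hs hc, div_eq_div_iff hs (mul_ne_zero hs hc)]
    linear_combination (-(g x + g (-x)) * (2 * (Real.sinh x : ℂ))) * keyC
  have hsplit : ∫ x in Ioi (0 : ℝ), F1 x = (∫ x in Ioi (0 : ℝ), F0 x) - ∫ x in Ioi (0 : ℝ), G x := by
    rw [setIntegral_congr_fun measurableSet_Ioi hpt, integral_sub hI0 hGI.integrableOn]
  rw [h1, h0, hsplit]
  ring

/-- The whole-line form: `∫₀^∞ (g(x) + g(−x))/(2 cosh(x/2)) dx = ∫ g(x)/(2 cosh(x/2)) dx`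
(the weight is even). [folklore] -/
private theorem integral_Ioi_symm_div_cosh_half (hg : IsWeilTest g) :
    ∫ x in Ioi (0 : ℝ), (g x + g (-x)) / (2 * Real.cosh (x / 2) : ℂ) =
      ∫ x : ℝ, g x / (2 * Real.cosh (x / 2) : ℂ) := by
  set H : ℝ → ℂ := fun x ↦ g x / (2 * Real.cosh (x / 2) : ℂ) with hH
  have hHc : Continuous H := by
    refine Continuous.div hg.1.continuous (by fun_prop) fun x ↦ ?_
    exact_mod_cast mul_ne_zero two_ne_zero (Real.cosh_pos (x / 2)).ne'
  have hHI : Integrable H := by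
    refine hHc.integrable_of_hasCompactSupport ?_
    simp only [hH, div_eq_mul_inv]
    exact hg.2.mul_right
  have hsum : ∀ x : ℝ, (g x + g (-x)) / (2 * Real.cosh (x / 2) : ℂ) = H x + H (-x) := by
    intro x
    simp only [hH, neg_div, Real.cosh_neg]
    ring
  simp_rw [hsum]
  rw [integral_add hHI.integrableOn (hHI.comp_neg.integrableOn), integral_comp_neg_Ioi 0 H, neg_zero,
    add_comm, intervalIntegral.integral_Iic_add_Ioi hHI.integrableOn hHI.integrableOn]

/-- **The parity term as the `sech(x/2)/2` functional**: for every test function `g`,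
`weilArchIntegralChar 1 g − weilArchIntegralChar 0 g = 2π ∫ g(x)/(2 cosh(x/2)) dx`, i.e.
`(1/2π)(A₁ − A₀)(g) = ½ ∫ g(x) sech(x/2) dx`.
[cite: Weil1952FormulesExplicites, (10)–(11) pp. 258–262 (K_{1,0} − K_{1,1} = 1/(e^{x/2} + e^{−x/2}))] -/
theorem weilArchIntegralChar_one_sub_zero_eq_integral_sech (hg : IsWeilTest g) :
    weilArchIntegralChar 1 g - weilArchIntegralChar 0 g =
      2 * π * ∫ x : ℝ, g x / (2 * Real.cosh (x / 2) : ℂ) := by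
  rw [weilArchIntegralChar_one_sub_zero hg, integral_Ioi_symm_div_cosh_half hg]

/-! ### Frequency side at test functions; the `sech` Fourier pair; positivity at `φ ⋆ φ̃` -/

open Literature.Analysis.SpecialFunctions.Complex in
/-- Integrability of the parity-shifted archimedean integrand `k̂(1/2 + it) Re ψ(x + it/2)` for a test
function `k` and `x > 0` (decay of `k̂` on the critical line against the logarithmic growth of `ψ`,
`integrable_mul_weilMellin_vertical_of_norm_le_log`).
[cite: Bombieri2000Weil, §2 (convergence of the Gamma-factor integral against f̃ on Re s = 1/2)] -/
theorem integrable_weilMellin_mul_re_digamma_shift {k : ℝ → ℂ} (hk : IsWeilTest k) {x : ℝ}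
    (hx : 0 < x) :
    Integrable fun t : ℝ ↦ weilMellin k (1 / 2 + t * I) *
      ((Complex.digamma (x + t / 2 * I)).re : ℂ) := by
  obtain ⟨C, hC⟩ := exists_norm_digamma_vertical_le hx
  set F : ℝ → ℂ := fun t ↦ ((Complex.digamma (x + t / 2 * I)).re : ℂ) with hF
  have hw : ∀ t : ℝ, (x : ℂ) + (t : ℂ) / 2 * I = (x : ℂ) + ((t / 2 : ℝ) : ℂ) * I := by
    intro t; push_cast; ring
  have hFc : Continuous F := by
    refine continuous_ofReal.comp (Complex.continuous_re.comp ?_)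
    refine continuousOn_digamma.comp_continuous (by fun_prop) fun t ↦ ?_
    rw [hw t]
    simpa using hx
  have hFb : ∀ t : ℝ, ‖F t‖ ≤ C + Real.log (1 + |t|) := by
    intro t
    have h1 : ‖F t‖ ≤ ‖Complex.digamma (x + t / 2 * I)‖ := by
      simp only [hF, Complex.norm_real, Real.norm_eq_abs]
      exact Complex.abs_re_le_norm _
    have h2 := hC (t / 2)
    rw [← hw t] at h2
    have h3 : Real.log (1 + |t / 2|) ≤ Real.log (1 + |t|) := by
      refine Real.log_le_log (by positivity) ?_
      rw [abs_div, abs_two]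
      linarith [abs_nonneg t]
    linarith
  have hI := integrable_mul_weilMellin_vertical_of_norm_le_log hk (1 / 2) hFc hFb
  refine hI.congr (Eventually.of_forall fun t ↦ ?_)
  simp only [hF]
  have : ((1 / 2 : ℝ) : ℂ) + (t : ℂ) * I = 1 / 2 + (t : ℂ) * I := by push_cast; ring
  rw [this, mul_comm]

/-- **The parity term in frequency space**: for every test function `k`,
`weilArchIntegralChar 1 k − weilArchIntegralChar 0 k = ∫ k̂(1/2 + it) · π/cosh(πt) dt`
(subtract the two digamma integrals; pointwise `re_digamma_par_one_sub_zero`).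
[cite: Weil1952FormulesExplicites, (10) p. 258; AndrewsAskeyRoy1999, (1.2.15)] -/
theorem weilArchIntegralChar_one_sub_zero_eq_integral_freq {k : ℝ → ℂ} (hk : IsWeilTest k) :
    weilArchIntegralChar 1 k - weilArchIntegralChar 0 k =
      ∫ t : ℝ, weilMellin k (1 / 2 + t * I) * ((π / Real.cosh (π * t) : ℝ) : ℂ) := by
  have e0 : ∀ t : ℝ, (1 / 4 + ((0 : ℕ) : ℂ) / 2 + t / 2 * I) = ((1 / 4 : ℝ) : ℂ) + t / 2 * I := by
    intro t; push_cast; ring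
  have e1 : ∀ t : ℝ, (1 / 4 + ((1 : ℕ) : ℂ) / 2 + t / 2 * I) = ((3 / 4 : ℝ) : ℂ) + t / 2 * I := by
    intro t; push_cast; ring
  have h0 := integrable_weilMellin_mul_re_digamma_shift hk (x := 1 / 4) (by norm_num)
  have h1 := integrable_weilMellin_mul_re_digamma_shift hk (x := 3 / 4) (by norm_num)
  unfold weilArchIntegralChar
  simp_rw [e0, e1]
  rw [← integral_sub h1 h0]
  refine integral_congr_ae (Eventually.of_forall fun t ↦ ?_)
  have hp := re_digamma_par_one_sub_zero t
  rw [e0, e1] at hp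
  simp only
  rw [← mul_sub, ← Complex.ofReal_sub, hp]

/-- **`sech(πt)` and `sech(x/2)/2` are a Fourier pair, through the digamma function**: for every
test function `k`, `∫ k̂(1/2 + it) π/cosh(πt) dt = 2π ∫ k(x)/(2 cosh(x/2)) dx`
(both sides equal `weilArchIntegralChar 1 k − weilArchIntegralChar 0 k`: Weil's two printed forms of the
archimedean term — (10) on the line `Re s = 1/2`, (11) with the kernels `K_{1,f}` — compared at `f = 1`
and `f = 0`). [cite: Weil1952FormulesExplicites, (10) p. 258 and (11) pp. 261–262 with K_{1,f} p. 262 (f = 0, 1)] -/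
theorem integral_weilMellin_mul_sech_eq (hk : IsWeilTest g) :
    ∫ t : ℝ, weilMellin g (1 / 2 + t * I) * ((π / Real.cosh (π * t) : ℝ) : ℂ) =
      2 * π * ∫ x : ℝ, g x / (2 * Real.cosh (x / 2) : ℂ) := by
  rw [← weilArchIntegralChar_one_sub_zero_eq_integral_freq hk,
    weilArchIntegralChar_one_sub_zero_eq_integral_sech hk]

/-- **At `g = φ ⋆ φ̃` the parity term is a positive quadratic form**:
`weilArchIntegralChar 1 (φ ⋆ φ̃) − weilArchIntegralChar 0 (φ ⋆ φ̃) = ∫ |φ̂(1/2 + it)|² π/cosh(πt) dt`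
(a real, non-negative number), i.e. `(1/2π)(A₁ − A₀)(φ ⋆ φ̃) = ½ ∫ |φ̂(1/2+it)|² sech(πt) dt`
`= ½ ∫ (φ ⋆ φ̃)(x) sech(x/2) dx` — the «parity bonus» of an odd character over `ζ` on the same window.
[cite: Weil1952FormulesExplicites, (10)–(11) pp. 258–262 (K_{1,1} vs K_{1,0} at a real place)] -/
theorem weilArchIntegralChar_one_sub_zero_weilConv_weilReflect {φ : ℝ → ℂ} (hφ : IsWeilTest φ) :
    weilArchIntegralChar 1 (weilConv φ (weilReflect φ)) - weilArchIntegralChar 0 (weilConv φ (weilReflect φ)) =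
      ((∫ t : ℝ, ‖weilMellin φ (1 / 2 + t * I)‖ ^ 2 * (π / Real.cosh (π * t)) : ℝ) : ℂ) := by
  rw [weilArchIntegralChar_one_sub_zero_eq_integral_freq (hφ.weilConv hφ.weilReflect),
    ← integral_complex_ofReal]
  refine integral_congr_ae (Eventually.of_forall fun t ↦ ?_)
  simp only
  rw [weilMellin_weilConv_weilReflect_half hφ]
  push_cast
  ring

/-- Hence the parity term at `φ ⋆ φ̃` is `≥ 0`: `A₀(φ ⋆ φ̃) ≤ A₁(φ ⋆ φ̃)` as real parts (and both sides
are real). Quantitative form of the inequality `Re ψ(1/4 + it/2) ≤ Re ψ(3/4 + it/2)` used by the GRH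
arm's odd-character transfers. [cite: Weil1952FormulesExplicites, (10)–(11) pp. 258–262] -/
theorem re_weilArchIntegralChar_zero_le_one_weilConv_weilReflect {φ : ℝ → ℂ} (hφ : IsWeilTest φ) :
    (weilArchIntegralChar 0 (weilConv φ (weilReflect φ))).re ≤
      (weilArchIntegralChar 1 (weilConv φ (weilReflect φ))).re := by
  have h := congrArg Complex.re (weilArchIntegralChar_one_sub_zero_weilConv_weilReflect hφ)
  rw [Complex.sub_re, Complex.ofReal_re] at h
  have hnn : 0 ≤ ∫ t : ℝ, ‖weilMellin φ (1 / 2 + t * I)‖ ^ 2 * (π / Real.cosh (π * t)) :=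
    integral_nonneg fun t ↦ mul_nonneg (by positivity) (div_nonneg Real.pi_pos.le (Real.cosh_pos _).le)
  linarith

end WeilArchParity

end Literature.NumberTheory.LFunctions

end
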